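import Mathlib
import Summits.ResolutionOfSingularities.ResolutionOfSingularities.Theses.TropicalLinks
import Literature.AlgebraicGeometry.Motives.Varieties

/-!
# Birth skeleton (BC3) — piece `RegularProjectiveClosure` (child 1/3 of the BC2 split of
`TropicalLinks.InductiveStep`)

Line "Goodman with regular centres": (stub 1) some principal open `U_g` of the very affine `U = V(I)`
has a REGULAR PROJECTIVE COMPACTIFICATION `U_g ↪ Y ↪ ℙⁿ_k` (weak resolution: a regular projective model
containing a principal open — no morphism to `U`, no condition on the boundary); (stub 2) from such a
compactification one reaches, for a possibly smaller principal open `U_{g'}`, a regular projective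
CLOSURE, i.e. a regular projective model whose boundary is a hyperplane section (Goodman 1969: after a
blow-up centred in the boundary the complement of an affine open supports an ample divisor — here the
blow-up must keep regularity, e.g. by principalising the boundary ideal with regular centres).
`RegularProjectiveClosure_of` composes them (pure logic).
-/

namespace Summit.ResolutionOfSingularities.ResolutionOfSingularities.Cruxes.RegularProjectiveClosure.Birth

set_option linter.dupNamespace false

open scoped BigOperators Topology Manifold Classical MeasureTheory ProbabilityTheory Matrix InnerProductSpace ComplexConjugate ContinuousMap
open Filter Set Function TopologicalSpace MeasureTheory
open AlgebraicGeometry CategoryTheory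

/-- Laurent polynomial ring `k[x₁^±, …, x_N^±]`. -/
abbrev Lau (k : Type) [Field k] (N : ℕ) : Type := AddMonoidAlgebra k (Fin N → ℤ)

/-- coordinate ring `A_g = (k[x^±]/I)[g⁻¹]` of the principal open `U_g` of `U = V(I)`. -/
abbrev Ag {k : Type} [Field k] {N : ℕ} (I : Ideal (Lau k N)) (g : Lau k N) : Type :=
  Localization.Away (Ideal.Quotient.mk I g)

/-- chart-`i` generators `(1/f_i, f_0/f_i, …, f_{n-1}/f_i)` of the projective closure, inside `A_g[1/f_i]`. -/
noncomputable abbrev chartGens {k : Type} [Field k] {N : ℕ} {I : Ideal (Lau k N)} {g : Lau k N} {n : ℕ}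
    (f : Fin n → Ag I g) (i : Fin n) : Fin (n + 1) → Localization.Away (f i) :=
  Fin.cons (IsLocalization.Away.invSelf (f i))
    (fun j => algebraMap (Ag I g) (Localization.Away (f i)) (f j) * IsLocalization.Away.invSelf (f i))

/-- coordinate ring of chart `i` (`x_{i+1} ≠ 0`) of the projective closure of `U_g ↪ 𝔸ⁿ ⊆ ℙⁿ`. -/
abbrev Chart {k : Type} [Field k] {N : ℕ} {I : Ideal (Lau k N)} {g : Lau k N} {n : ℕ}
    (f : Fin n → Ag I g) (i : Fin n) : Type :=
  MvPolynomial (Fin (n + 1)) k ⧸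
    RingHom.ker (MvPolynomial.aeval (chartGens f i) : MvPolynomial (Fin (n + 1)) k →ₐ[k] Localization.Away (f i))

/-- local equation `x_0/x_{i+1}` of the hyperplane at infinity in chart `i`. -/
noncomputable abbrev tInf {k : Type} [Field k] {N : ℕ} {I : Ideal (Lau k N)} {g : Lau k N} {n : ℕ}
    (f : Fin n → Ag I g) (i : Fin n) : Chart f i :=
  Ideal.Quotient.mk _ (MvPolynomial.X 0)

/-- the affine embedding `f` of `U_g` has REGULAR projective closure (all `n + 1` charts regular). -/
def RegularClosureDatum (k : Type) [Field k] {N : ℕ} (I : Ideal (Lau k N)) (g : Lau k N) (n : ℕ)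
    (f : Fin n → Ag I g) : Prop :=
  Function.Surjective (MvPolynomial.aeval f : MvPolynomial (Fin n) k →ₐ[k] Ag I g) ∧
  (∀ (P : Ideal (Ag I g)) [P.IsPrime], IsRegularLocalRing (Localization.AtPrime P)) ∧
  ∀ (i : Fin n) (P : Ideal (Chart f i)) [P.IsPrime], IsRegularLocalRing (Localization.AtPrime P)

/-- the hyperplane at infinity of the closure is a strict normal crossings divisor (Stacks 0BI9, local form). -/
def SncBoundaryDatum (k : Type) [Field k] {N : ℕ} (I : Ideal (Lau k N)) (g : Lau k N) (n : ℕ)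
    (f : Fin n → Ag I g) : Prop :=
  ∀ (i : Fin n) (P : Ideal (Chart f i)) [P.IsPrime], tInf f i ∈ P →
    ∃ (r e : ℕ) (x : Fin r → Localization.AtPrime P) (y : Fin e → Localization.AtPrime P),
      1 ≤ r ∧ ringKrullDim (Localization.AtPrime P) = ((r + e : ℕ) : WithBot ℕ∞) ∧
      Ideal.span (Set.range x ∪ Set.range y) = IsLocalRing.maximalIdeal (Localization.AtPrime P) ∧
      (Ideal.span {algebraMap (Chart f i) (Localization.AtPrime P) (tInf f i)}).radical =
        Ideal.span {∏ l, x l}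

/-- MIRROR of the child statement (verbatim one-line term of children.json; after the split the
conclusion of `RegularProjectiveClosure_of` is switched to `TropicalLinks.RegularProjectiveClosure`,
`Iff.rfl`). -/
def RegularProjectiveClosure : Prop :=
  ∀ p : ℕ, p.Prime → ∀ (k : Type) [Field k] [CharP k p] [IsAlgClosed k] (N : ℕ) (I : Ideal (AddMonoidAlgebra k (Fin N → ℤ))), I.IsPrime → ∃ g ∉ I, ∃ (n : ℕ) (f : Fin n → Localization.Away (Ideal.Quotient.mk I g)), (Function.Surjective (MvPolynomial.aeval f : MvPolynomial (Fin n) k →ₐ[k] Localization.Away (Ideal.Quotient.mk I g)) ∧ (∀ (P : Ideal (Localization.Away (Ideal.Quotient.mk I g))) [P.IsPrime], IsRegularLocalRing (Localization.AtPrime P)) ∧ ∀ (i : Fin n) (P : Ideal (MvPolynomial (Fin (n + 1)) k ⧸ RingHom.ker (MvPolynomial.aeval (Fin.cons (IsLocalization.Away.invSelf (f i)) (fun j => algebraMap (Localization.Away (Ideal.Quotient.mk I g)) (Localization.Away (f i)) (f j) * IsLocalization.Away.invSelf (f i)) : Fin (n + 1) → Localization.Away (f i)) : MvPolynomial (Fin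 (n + 1)) k →ₐ[k] Localization.Away (f i)))) [P.IsPrime], IsRegularLocalRing (Localization.AtPrime P))

/-- "`U_g` has a regular projective compactification over `k`": a closed `k`-subscheme `Y ↪ ℙⁿ_k`,
integral and regular, and an open immersion `Spec A_g ↪ Y` compatible with the `k`-structures. -/
def HasRegularProjectiveCompactification (k : Type) [Field k] {N : ℕ} (I : Ideal (Lau k N)) (g : Lau k N) :
    Prop :=
  ∃ (Y : Scheme.{0}) (n : ℕ)
    (ι : Y ⟶ (Literature.AlgebraicGeometry.Motives.projectiveSpace n k).left)
    (j : Spec (.of (Ag I g)) ⟶ Y),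
    IsClosedImmersion ι ∧ IsOpenImmersion j ∧ IsIntegral Y ∧
    Literature.AlgebraicGeometry.Resolution.Scheme.IsRegular Y ∧
    j ≫ ι ≫ (Literature.AlgebraicGeometry.Motives.projectiveSpace n k).hom =
      Spec.map (CommRingCat.ofHom (algebraMap k (Ag I g)))

/-- STUB 1 (weak resolution, morphism-free): every very affine integral `U = V(I)` over an
algebraically closed field of characteristic `p` has a principal open `U_g` with a regular projective
compactification. Open in dimension `≥ 4` (Abhyankar 1966 / Cossart–Piltant 2019 give dimension `≤ 3`). -/
theorem stub_regularCompactification :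
    ∀ p : ℕ, p.Prime → ∀ (k : Type) [Field k] [CharP k p] [IsAlgClosed k] (N : ℕ) (I : Ideal (Lau k N)),
      I.IsPrime → ∃ g ∉ I, HasRegularProjectiveCompactification k I g := by
  sorry

/-- STUB 2 (Goodman with regular centres): a regular projective compactification of some `U_g`
yields, for some principal open `U_{g'}`, an affine embedding with REGULAR projective CLOSURE (the
boundary becomes a hyperplane section, i.e. supports an ample divisor, without losing regularity). -/
theorem stub_goodmanRegularClosure :
    ∀ p : ℕ, p.Prime → ∀ (k : Type) [Field k] [CharP k p] [IsAlgClosed k] (N : ℕ) (I : Ideal (Lau k N)),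
      I.IsPrime → ∀ g ∉ I, HasRegularProjectiveCompactification k I g →
        ∃ g' ∉ I, ∃ (n : ℕ) (f : Fin n → Ag I g'), RegularClosureDatum k I g' n f := by
  sorry

/-- COMPOSITION (kernel-checked, no sorry of its own): the two stubs give the piece. -/
theorem RegularProjectiveClosure_of
    (h₁ : ∀ p : ℕ, p.Prime → ∀ (k : Type) [Field k] [CharP k p] [IsAlgClosed k] (N : ℕ) (I : Ideal (Lau k N)),
      I.IsPrime → ∃ g ∉ I, HasRegularProjectiveCompactification k I g)
    (h₂ : ∀ p : ℕ, p.Prime → ∀ (k : Type) [Field k] [CharP k p] [IsAlgClosed k] (N : ℕ) (I : Ideal (Lau k N)),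
      I.IsPrime → ∀ g ∉ I, HasRegularProjectiveCompactification k I g →
        ∃ g' ∉ I, ∃ (n : ℕ) (f : Fin n → Ag I g'), RegularClosureDatum k I g' n f) :
    RegularProjectiveClosure := by
  intro p hp k _ _ _ N I hI
  obtain ⟨g, hg, hY⟩ := h₁ p hp k N I hI
  obtain ⟨g', hg', n, f, hf⟩ := h₂ p hp k N I hI g hg hY
  exact ⟨g', hg', n, f, hf⟩

/-- The piece from the stubs as stated. -/
theorem RegularProjectiveClosure_holds : RegularProjectiveClosure :=
  RegularProjectiveClosure_of stub_regularCompactification stub_goodmanRegularClosure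

end Summit.ResolutionOfSingularities.ResolutionOfSingularities.Cruxes.RegularProjectiveClosure.Birth
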